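/-
Copyright (c) 2026 the pub-hodgecm-mathlib formalisation cell (harness21).  Prover seat hodgecm-mathlib-K2Liu-p03 (g8), Track B «K2-LIT»,
#184♮ = hLiu418 = `stmt-HodgeConjecture-24832`; socket #41, KIND 1 — (K1a-T) THE SINGULAR TAIL OF RECORD, FILE 1∕2 «EULER» (K1-a♮ line lead K2E5-p16 (g8) WORD #10 (1),
2026-09-05T00:05:44Z; chair K2-lead (g2) VALVE 00:05:02Z (1)(ii); desk GO 00:16:58Z): the three ENGINES of the producer of ★ p863404 `K2LiuKindOneSingularTermPackage` §2 (ii)'s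
letters — ★ G1 at any index with the K1 tail algebra, the corner data of record, and the Σ∏ Fubini of a sliced family.  FILE 2∕2 `K2LiuKindOneSingularTailOfRecord` is the head.
THEOREMS ONLY (no `def`, no `instance`, no notation, no named-fact hypothesis, no `sorry`).
-/
import Summits.HodgeConjecture.HodgeConjecture.Theorems.K2LiuKindWJointIntegrable                -- ★ (x-a-int) `integrable_tensor_prod_pi` (⊇ ★ (x-a) ED. 1–2 `kindWPlaces`, `kindWFinset`, `kindWPart`, ★ G1, ★ p862531 Fubini)
import Summits.HodgeConjecture.HodgeConjecture.Theorems.K2LiuRankOneSingularEulerContinued       -- ★ (K1a-4) ED. 2 §3 `tprod_eq_scalarK1_mul_finsetProd_cm` (the K1 tail algebra)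
import Summits.HodgeConjecture.HodgeConjecture.Theorems.K2LiuRankOneIndexValueTwoCorner           -- ★ (V-b) `corner_eq_val₂_mul_norm`, `hval₂`
import Summits.HodgeConjecture.HodgeConjecture.Theorems.K2LiuRankOneCornerIndexTransport          -- ★ p862643 (K1a-1) `exists_rat_levi_blocks_levi_map`, `conj_index_eq_single`, `whittakerDelta_eq_whittakerDelta_conj_index`
import Summits.HodgeConjecture.HodgeConjecture.Theorems.K2LiuIntertwiningDeltaUnconditional       -- ★ `exists_leviHom_blk_eq` (a Levi chart by value)
import Summits.HodgeConjecture.HodgeConjecture.Theorems.K2LiuUnipDeltaConjMeasurePreserving       -- ★ α2c `measurePreserving_conj_levi`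
import Summits.HodgeConjecture.HodgeConjecture.Theorems.K2LiuRankOneRowSection                    -- ★ `exists_normalised_rowSection`
import Summits.HodgeConjecture.HodgeConjecture.Theorems.K2LiuRankOneTwoByTwo                      -- ★ `exists_vecMulVec_of_det_eq_zero`
import HarnessLib

/-!
# Crux `HLiu418`, socket #41, KIND 1 a♮ — (K1a-T) FILE 1∕2 `K2LiuKindOneSingularTailEuler`: ★ G1 AT ANY INDEX WITH THE K1 TAIL ALGEBRA, THE CORNER DATA OF RECORD,
# AND THE Σ∏ HEAD OF A SLICED FAMILY

Cell `hodgecm-mathlib`, crux item hLiu418 = `stmt-HodgeConjecture-24832` (helper lane `--supports … --as helper`, count-neutral), route of record `HCCMUnconditional`;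
squad K2 ∕ K2Liu, road `K2_Liu`, socket #41 `sig_K2LiuSiegelEisensteinContinuation`, KIND 1, block K1-a♮.  CONSUMER (via FILE 2∕2): ★ p863404 (K2E4-p10 (g10))
`K2LiuKindOneSingularTermPackage.exists_kindOne_singularTermPackage_of_placeLetters` §2 (ii) — the letters `c D P hP Pm hPT HT htail I T q hq A W hsplit`.

THE MATHEMATICS ([KudlaRallis1994, §2 (2.10)–(2.12)]; [Tan1999, §3, §4 Prop. 4.8]; [Shimura1997, §18.4]; K2E5-p16 (g8) census `CENSUS-K1a-GK` §1∕§3, road B «Euler road»).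
For a rank-one `T_L`-skew index `S = u ⊗ w` the big-cell term of the `S`-th Fourier coefficient of a Siegel section `f_s` is moved to the CORNER index `S♭ = σ E₁₁` by the
rational Levi element `Λ(γ[w])` (★ p862643 (K1a-1), Haar-preserving by ★ α2c); there ★ G1 `whittakerDelta_eq_mul_tprod_euler` factorises
`W_{S♭}(f_s)(h′) = I_U(S♭,s,h′) · ∏'_{v∉U} ∫ conj ψ_{S♭}(ι_v y) Λ_{s,v}((w_Δ)_v y) dν_v` off the KIND-W exceptional set `U = kindWPlaces ↑T₀ S♭ h′` (★ (x-a) ED. 1: `S♭⁻¹ = 0` is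
integral, so ★ `K2LiuSiegelEisensteinKindWLetters` §1 supplies ★ G1's `hh hw hS` at a singular index verbatim); the local factor off a finite set is `c¹_v(s) · Σ_{k≤m_v}(ε_v q_v^{1−2s})^k`
(★ p863366, `m_v = ord_v τ`), so the restricted product folds to the K1 scalar of record times a FINITE product of polynomials (★ (K1a-4) ED. 2 §3), and the head `I_U` of a
sliced family (finite sum of pure tensors at `U ∪ ∞`, ★ (KW-fac)) is the Σ∏ of the raw archimedean and local twisted integrals (★ p862531 under ★ `integrable_tensor_prod_pi`).
* §1 **`whittakerDelta_eq_kindWPart_mul_scalarK1_mul_prod`** — THE K1 TWIN OF ★ (W1) `whittakerDelta_eq_kindWPart_mul` (ANY index `S ∈ M_n(L)`, any `n`): the Whittaker–Euler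
  data's letters `T₀ νN νv hνK νinf hσ hmap hχ fT hfac hG` VERBATIM as ★ (W1), `1∕2 < re s`, and the K1 per-place letter off `U(S,h)` BY VALUE in ★ p863366's shape
  (`m Dm hm hI`) ⇒ `W_S(f_s)(h) = I_U(S,s,h) · [ζ^U_{L⁺}(2s) ∕ (ζ^U_{L⁺}(2s+1)·L^U(2s+2, ε_{L∕L⁺}))] · ∏_{v ∈ Dm, v ∉ U} Σ_{k≤m v}(ε_v q_v^{1−2s})^k` (★ G1 ∘ ★ tail algebra).
* §2 **`exists_cornerData_of_record`** — per skew `S`: the corner value `σc(S)` and the Levi translate `gc(S)` from ★ (K1a-1) with ALL its letters discharged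
  (★ `exists_leviHom_blk_eq`, ★ `exists_normalised_rowSection`, ★ `measurePreserving_conj_levi`, ★ `exists_vecMulVec_of_det_eq_zero`): for rank-one `S`,
  `t₁·Tr(σc(S)δ) ≠ 0` (`mul_trace_mul_imagUnit_ne_zero` ∘ ★ (V-b) `corner_eq_val₂_mul_norm` + `hval₂`: `σc = δ · val₂ S · N(t)`) and `W_S(f)(h) = W_{σc E₁₁}(f)(gc S · h)` for EVERY
  Siegel section and Haar `νN`.
* §3 **`kindWPart_slice_eq_sum_mul_prod`** — the head `I_T` of a family sliced as `Σ_j Finf j ⊗ ⨂_{v∈T} Fv j v` IS `Σ_j (∫ arch) · ∏_{v∈T} (∫ local)` at ANY index and point, given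
  per-factor integrability (★ p862531 ∘ ★ `integrable_tensor_prod_pi`, `Finset.prod_coe_sort`) — the K1 twin of ★ `kindWPart_eq_sum_mul_prod_of_letters`, uncontinued.
HONEST LABEL.  Count-neutral helper (Euler bookkeeping + transport); it closes no socket: `HC_CM` is proved only modulo the 7 printed citations (2 remaining named inputs:
hLiu418 = `stmt-HodgeConjecture-24832`, h413 = `stmt-HodgeConjecture-24833`) until rung 0 closes.

## References
* [KudlaRallis1994] S. Kudla, S. Rallis, *A regularized Siegel–Weil formula: the first term identity*, Ann. of Math. 140 (1994): §2 (2.10)–(2.12).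
* [Tan1999] V. Tan, *Poles of Siegel Eisenstein series on U(n,n)*, Canad. J. Math. 51 (1999): §3, §4 Prop. 4.8.
* [Shimura1997] G. Shimura, *Euler Products and Eisenstein Series*, CBMS 93 (1997): §18.1, §18.3–18.4.
* [MoeglinWaldspurger1995] C. Mœglin, J.-L. Waldspurger, *Spectral Decomposition and Eisenstein Series* (1995): II.1.7.
* [CasselsFrohlichANT1967] Cassels–Fröhlich (eds.), *Algebraic Number Theory* (1967): Ch. XV (Tate) Lemma 3.2.1, Thm. 3.3.1.
-/

set_option autoImplicit false
-- the mandated namespace repeats the single-problem summit's segment (`HodgeConjecture.HodgeConjecture`)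
set_option linter.dupNamespace false

noncomputable section

open scoped Matrix RestrictedProduct ENNReal NNReal Topology ComplexConjugate
open NumberField IsDedekindDomain MeasureTheory Measure Filter Set

namespace Summit.HodgeConjecture.HodgeConjecture.Cruxes.HLiu418.K2LiuKindOneSingularTailEuler

open Literature.NumberTheory.Automorphic Literature.NumberTheory.GaloisRepresentations Literature.NumberTheory.LFunctions
open Literature.NumberTheory.GelbartRogawski1991 Literature.NumberTheory.GelbartRogawski1991.GRConstruction
open Literature.NumberTheory.GelbartRogawski1991.UnitaryDualPair
open Literature.NumberTheory.K2Lit.SiegelDoubled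
open Literature.NumberTheory.K2Lit.PlaceSplitting
open Literature.MeasureTheory.RestrictedProduct
open Literature.Topology.Algebra.RestrictedProduct (inH)
open Summit.HodgeConjecture.HodgeConjecture.Cruxes.HLiu418.K2LiuSiegelUnipotentLocalDefs
open Summit.HodgeConjecture.HodgeConjecture.Cruxes.HLiu418.K2LiuSiegelUnipotentSplitDefs
open Summit.HodgeConjecture.HodgeConjecture.Cruxes.HLiu418.K2LiuSiegelUnipotentSplitAtDefs
open Summit.HodgeConjecture.HodgeConjecture.Cruxes.HLiu418.K2LiuSiegelUnipotentFourierDefs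
open Summit.HodgeConjecture.HodgeConjecture.Cruxes.HLiu418.K2LiuWhittakerDeltaEulerProduct (whittakerDelta_eq_mul_tprod_euler)
open Summit.HodgeConjecture.HodgeConjecture.Cruxes.HLiu418.K2LiuSiegelEisensteinKindWLetters
open Summit.HodgeConjecture.HodgeConjecture.Cruxes.HLiu418.K2LiuRankOneSingularEulerContinued (tprod_eq_scalarK1_mul_finsetProd_cm)

variable (L : Type) [Field L] [NumberField L] [IsCMField L]

/-! ## §1 The K1 twin of ★ (W1): ★ G1 at any index, the tail folded to the K1 scalar of record times a finite product of polynomials -/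

section Euler

variable {N M n : ℕ} (e : Fin N × Fin M ≃ Fin n)
  (dV : Fin N → L) (hdV : ∀ i, IsCMField.complexConj L (dV i) = dV i)
  (dW : Fin M → L) (hdW : ∀ i, IsCMField.complexConj L (dW i) = dW i)
  [DecidableEq (HeightOneSpectrum (𝓞 (Fp L)))]
  [MeasurableSpace ↥(unipDelta L e dV hdV dW hdW)] [BorelSpace ↥(unipDelta L e dV hdV dW hdW)]
  [MeasurableSpace ↥(unipDeltaArch L e dV hdV dW hdW)] [BorelSpace ↥(unipDeltaArch L e dV hdV dW hdW)]
  [∀ v : HeightOneSpectrum (𝓞 (Fp L)), MeasurableSpace ↥(unipDeltaLoc L e dV hdV dW hdW v)] [∀ v : HeightOneSpectrum (𝓞 (Fp L)), BorelSpace ↥(unipDeltaLoc L e dV hdV dW hdW v)]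

set_option maxHeartbeats 800000 in -- MEASURED class of ★ (W1) `whittakerDelta_eq_kindWPart_mul` ∕ ★ G1, whose statement this one repeats (default 200 000 times out at `whnf` of the statement); plain `rw`∕`exact`
/-- **§1 THE K1 TWIN OF ★ (W1) — ★ G1 AT ANY INDEX, THE TAIL FOLDED TO THE K1 SCALAR OF RECORD.**  The Whittaker–Euler data's letters VERBATIM as ★ (W1)
`whittakerDelta_eq_kindWPart_mul` (`T₀ νN νv hνK νinf hσ hmap hχ fT hfac`, the integrability `hG` of ★ O41.3 ∕ ★ (x-c) by value), an index `S ∈ M_n(L)` (singular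
allowed: `S⁻¹ = 0` is integral), `1∕2 < re s`, and the K1 PER-PLACE LETTER off `U(S,h) = kindWPlaces ↑T₀ S h` in ★ p863366's shape — exponents `m v` vanishing off the finite
`Dm` (`hm`) and `hI : ∫ conj ψ_S(ι_v y)·Λ_{s,v}((w_Δ)_v y) dν_v = c¹_v(s)·Σ_{k ∈ range (m v + 1)}(ε_v q_v^{1−2s})^k`.  THEN
`W_S(f_s)(h) = I_U(S,s,h) · [ζ^U_{L⁺}(2s) ∕ (ζ^U_{L⁺}(2s+1)·L^U(2s+2, ε_{L∕L⁺}))] · ∏_{v ∈ Dm, v ∉ U} Σ_{k ∈ range (m v + 1)}(ε_v q_v^{1−2s})^k`, `I_U = kindWPart` (★ (x-a) ED. 1).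
Proof: ★ G1 at `T := kindWFinset T₀ S h` (letters `hh hw hS hχ` from ★ (x-a) §1) ∘ ★ `tprod_eq_scalarK1_mul_finsetProd_cm` (`P v = 1` off `Dm` since `m v = 0`).
[cite: KudlaRallis1994, §2 (2.10)–(2.12)] [cite: Tan1999, §3; §4 Prop. 4.8] [cite: CasselsFrohlichANT1967, Ch. XV Lemma 3.2.1, Thm. 3.3.1] -/
theorem whittakerDelta_eq_kindWPart_mul_scalarK1_mul_prod (T₀ : Finset (HeightOneSpectrum (𝓞 (Fp L))))
    (νN : Measure ↥(unipDelta L e dV hdV dW hdW))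
    (νv : ∀ v : HeightOneSpectrum (𝓞 (Fp L)), Measure ↥(unipDeltaLoc L e dV hdV dW hdW v)) [∀ v, (νv v).IsHaarMeasure] [∀ v, SigmaFinite (νv v)]
    (hνK : ∀ v, νv v (((inH (fun v => UnitaryGroup.localInt L (IsCMField.complexConj L) (n + n) (hermD L e dV hdV dW hdW) v)
      (fun v => unipDeltaLoc L e dV hdV dW hdW v) v) : Subgroup ↥(unipDeltaLoc L e dV hdV dW hdW v)) : Set ↥(unipDeltaLoc L e dV hdV dW hdW v)) = 1)
    (νinf : Finset (HeightOneSpectrum (𝓞 (Fp L))) → Measure ↥(unipDeltaArch L e dV hdV dW hdW)) (hσ : ∀ T, SigmaFinite (νinf T))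
    (hmap : ∀ T : Finset (HeightOneSpectrum (𝓞 (Fp L))), Measure.map (unipDeltaSplitAt L e dV hdV dW hdW T) νN =
      (νinf T).prod ((Measure.pi fun v : T => νv v.1).prod
        (rpMeasure (fun v : {v : HeightOneSpectrum (𝓞 (Fp L)) // v ∉ T} => ((inH (fun v => UnitaryGroup.localInt L (IsCMField.complexConj L) (n + n) (hermD L e dV hdV dW hdW) v)
          (fun v => unipDeltaLoc L e dV hdV dW hdW v) v.1 : Subgroup ↥(unipDeltaLoc L e dV hdV dW hdW v.1)) : Set ↥(unipDeltaLoc L e dV hdV dW hdW v.1))) (fun v => νv v.1) ∅)))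
    {χ : HeckeCharacter L} (hχ : ∀ v, v ∉ T₀ → ∀ w' : UnitaryGroup.PlacesOver L v, χ.IsUnramifiedAt w'.1)
    {f : ℂ → HA L e dV hdV dW hdW → ℂ}
    {fT : ∀ T : Finset (HeightOneSpectrum (𝓞 (Fp L))), ℂ → UnitaryGroup.arch (Fp L) L (IsCMField.complexConj L) (n + n) (hermD L e dV hdV dW hdW) ×
      (Π v : T, UnitaryGroup.localPi L (IsCMField.complexConj L) (n + n) (hermD L e dV hdV dW hdW) v.1) → ℂ}
    (hfac : ∀ T : Finset (HeightOneSpectrum (𝓞 (Fp L))), T₀ ⊆ T → IsFactorizableOff L e dV hdV dW hdW T χ f (fT T))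
    (S : Matrix (Fin n) (Fin n) L) {s : ℂ} (hs : 1 / 2 < s.re) (h : HA L e dV hdV dW hdW)
    (hG : Integrable (fun u : ↥(unipDelta L e dV hdV dW hdW) =>
      conj (unipDeltaChar L e dV hdV dW hdW S (u : HA L e dV hdV dW hdW) : ℂ) * f s (weylDelta L e dV hdV dW hdW * (u : HA L e dV hdV dW hdW) * h)) νN)
    -- the K1 per-place letter off `U(S,h)`: exponents `m v` supported on `Dm`, local values `c¹_v(s) · Σ_{k ≤ m v} (ε_v q_v^{1−2s})^k` (★ p863366's shape)
    (m : HeightOneSpectrum (𝓞 (Fp L)) → ℕ) (Dm : Finset (HeightOneSpectrum (𝓞 (Fp L)))) (hm : ∀ v, v ∉ Dm → m v = 0)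
    (hI : ∀ v, v ∉ kindWPlaces L e dV hdV dW hdW (T₀ : Set (HeightOneSpectrum (𝓞 (Fp L)))) S h →
      ∫ y, conj (unipDeltaChar L e dV hdV dW hdW S
            (locToAdelic L e dV hdV dW hdW v (y : UnitaryGroup.localPi L (IsCMField.complexConj L) (n + n) (hermD L e dV hdV dW hdW) v)) : ℂ) *
          LambdaLoc L e dV hdV dW hdW v χ s
            (UnitaryGroup.evalPlace (Fp L) L (IsCMField.complexConj L) (n + n) (hermD L e dV hdV dW hdW) v
                (UnitaryGroup.finPart (Fp L) L (IsCMField.complexConj L) (n + n) (hermD L e dV hdV dW hdW) (weylDelta L e dV hdV dW hdW)) *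
              (y : UnitaryGroup.localPi L (IsCMField.complexConj L) (n + n) (hermD L e dV hdV dW hdW) v)) ∂(νv v) =
        (1 - (v.residueCard : ℂ) ^ (-(2 * s + 1))) * (1 - (quadraticHeckeCharCM L).valueAtUniformizer v * (v.residueCard : ℂ) ^ (-(2 * s + 2))) /
          (1 - (v.residueCard : ℂ) ^ (-(2 * s))) *
          ∑ k ∈ Finset.range (m v + 1), ((quadraticHeckeCharCM L).valueAtUniformizer v * (v.residueCard : ℂ) ^ (1 - 2 * s)) ^ k) :
    whittakerDelta L e dV hdV dW hdW νN S (f s) h =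
      kindWPart L e dV hdV dW hdW (kindWFinset L e dV hdV dW hdW T₀ S h) (νinf (kindWFinset L e dV hdV dW hdW T₀ S h)) νv
          (fT (kindWFinset L e dV hdV dW hdW T₀ S h)) S s h *
        (partialStandardL (kindWPlaces L e dV hdV dW hdW (T₀ : Set (HeightOneSpectrum (𝓞 (Fp L)))) S h) (fun _ => {1}) (2 * s) /
          (partialStandardL (kindWPlaces L e dV hdV dW hdW (T₀ : Set (HeightOneSpectrum (𝓞 (Fp L)))) S h) (fun _ => {1}) (2 * s + 1) *
            partialStandardL (kindWPlaces L e dV hdV dW hdW (T₀ : Set (HeightOneSpectrum (𝓞 (Fp L)))) S h)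
              (fun v => {(quadraticHeckeCharCM L).valueAtUniformizer v}) (2 * s + 2))) *
        ∏ v ∈ Dm.filter (fun v => v ∉ kindWFinset L e dV hdV dW hdW T₀ S h),
          ∑ k ∈ Finset.range (m v + 1), ((quadraticHeckeCharCM L).valueAtUniformizer v * (v.residueCard : ℂ) ^ (1 - 2 * s)) ^ k := by
  -- ★ G1 at `T := U(S,h)` (as a `Finset`), its letters `hh hw hS hχ` read off ★ (x-a) §1 (as ★ (W1))
  have hout : ∀ v, v ∉ kindWFinset L e dV hdV dW hdW T₀ S h → v ∉ kindWPlaces L e dV hdV dW hdW (T₀ : Set (HeightOneSpectrum (𝓞 (Fp L)))) S h :=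
    fun v hv hv' => hv ((mem_kindWFinset L e dV hdV dW hdW).2 hv')
  haveI := hσ (kindWFinset L e dV hdV dW hdW T₀ S h)
  obtain ⟨-, hW⟩ := whittakerDelta_eq_mul_tprod_euler L e dV hdV dW hdW (kindWFinset L e dV hdV dW hdW T₀ S h) νN νv (fun v _ => hνK v)
    (νinf (kindWFinset L e dV hdV dW hdW T₀ S h)) (hmap _)
    (fun v hv => hχ v fun hv' => not_mem_of_not_mem_kindWPlaces L e dV hdV dW hdW (hout v hv) (Finset.mem_coe.2 hv'))
    (hfac _ (subset_kindWFinset L e dV hdV dW hdW T₀ S h)) s S (h := h)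
    (fun v hv => evalPlace_mem_localInt_of_not_mem_kindWPlaces L e dV hdV dW hdW (hout v hv))
    (fun v hv => weylDelta_mem_localInt_of_not_mem_kindWPlaces L e dV hdV dW hdW (hout v hv))
    (fun v hv w i j => integral_of_not_mem_kindWPlaces L e dV hdV dW hdW (hout v hv) w i j) hG
  -- ★ the K1 tail algebra at `T := ↑(kindWFinset T₀ S h) = U(S,h)`, `D := Dm ∖ U(S,h)`, `P v := Σ_{k ≤ m v}(ε_v q_v^{1−2s})^k` (`= 1` off `Dm`)
  have hE := tprod_eq_scalarK1_mul_finsetProd_cm L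
    (((kindWFinset L e dV hdV dW hdW T₀ S h : Finset (HeightOneSpectrum (𝓞 (Fp L)))) : Set (HeightOneSpectrum (𝓞 (Fp L))))) hs
    (Dm.filter (fun v => v ∉ kindWFinset L e dV hdV dW hdW T₀ S h))
    (fun v hv => by
      rw [Finset.mem_filter] at hv
      exact fun hv' => hv.2 (Finset.mem_coe.1 hv'))
    (fun v => ∑ k ∈ Finset.range (m v + 1), ((quadraticHeckeCharCM L).valueAtUniformizer v * (v.residueCard : ℂ) ^ (1 - 2 * s)) ^ k)
    (fun v hv hvD => by
      have hvDm : v ∉ Dm := fun hvDm => hvD (Finset.mem_filter.2 ⟨hvDm, fun hv' => hv (Finset.mem_coe.2 hv')⟩)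
      rw [hm v hvDm, zero_add, Finset.sum_range_one, pow_zero])
    (fun v => ∫ y, conj (unipDeltaChar L e dV hdV dW hdW S
            (locToAdelic L e dV hdV dW hdW v.1 (y : UnitaryGroup.localPi L (IsCMField.complexConj L) (n + n) (hermD L e dV hdV dW hdW) v.1)) : ℂ) *
          LambdaLoc L e dV hdV dW hdW v.1 χ s
            (UnitaryGroup.evalPlace (Fp L) L (IsCMField.complexConj L) (n + n) (hermD L e dV hdV dW hdW) v.1
                (UnitaryGroup.finPart (Fp L) L (IsCMField.complexConj L) (n + n) (hermD L e dV hdV dW hdW) (weylDelta L e dV hdV dW hdW)) *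
              (y : UnitaryGroup.localPi L (IsCMField.complexConj L) (n + n) (hermD L e dV hdV dW hdW) v.1)) ∂(νv v.1))
    (fun v => hI v.1 fun hv' => v.2 (Finset.mem_coe.2 ((mem_kindWFinset L e dV hdV dW hdW).2 hv')))
  rw [hW, ← coe_kindWFinset L e dV hdV dW hdW T₀ S h, mul_assoc, ← hE]
  rfl

end Euler

/-! ## §2 The corner data of record: `σc(S)`, `gc(S) = Λ(γ[w])`, with `τ(σc S) ≠ 0` and the transport identity, all letters of ★ (K1a-1) discharged -/

section Corner

open Summit.HodgeConjecture.HodgeConjecture.Cruxes.HLiu418.K2LiuRankOneCornerIndexTransport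
  (exists_rat_levi_blocks_levi_map conj_index_eq_single whittakerDelta_eq_whittakerDelta_conj_index)
open Summit.HodgeConjecture.HodgeConjecture.Cruxes.HLiu418.K2LiuRankOneIndexValueTwoCorner (corner_eq_val₂_mul_norm hval₂ gramR_apply_same_ne_zero)
open Summit.HodgeConjecture.HodgeConjecture.Cruxes.HLiu418.K2LiuIntertwiningDeltaUnconditional (exists_leviHom_blk_eq)
open Summit.HodgeConjecture.HodgeConjecture.Cruxes.HLiu418.K2LiuUnipDeltaConjMeasurePreserving (measurePreserving_conj_levi)
open Summit.HodgeConjecture.HodgeConjecture.Cruxes.HLiu418.K2LiuRankOneRowSection (exists_normalised_rowSection)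
open Summit.HodgeConjecture.HodgeConjecture.Cruxes.HLiu418.K2LiuRankOneTwoByTwo (exists_vecMulVec_of_det_eq_zero)

variable {N M : ℕ} (e : Fin N × Fin M ≃ Fin 2)
  (dV : Fin N → L) (hdV : ∀ i, IsCMField.complexConj L (dV i) = dV i)
  (dW : Fin M → L) (hdW : ∀ i, IsCMField.complexConj L (dW i) = dW i)

/-- **`t₁ · Tr_{L∕L⁺}(σδ) ≠ 0` FOR `σ = δ · v · N(t)`** (`δ = imagUnit L`, `v ∈ L⁺ ∖ 0`, `t ∈ L ∖ 0`, `t₁ ∈ L⁺ ∖ 0`): `σδ = δ² · v · N(t) ∈ L⁺` is non-zero and the trace of an element of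
`L⁺` is twice it. [cite: Shimura1997, §18.1] -/
theorem mul_trace_mul_imagUnit_ne_zero {σ : L} {v : Fp L} (hv : v ≠ 0) {t : L} (ht : t ≠ 0)
    (hσ : σ = imagUnit L * (v : L) * (IsCMField.complexConj L t * t)) {t₁ : Fp L} (ht₁ : t₁ ≠ 0) :
    t₁ * Algebra.trace (Fp L) L (σ * imagUnit L) ≠ 0 := by
  haveI : Algebra.IsQuadraticExtension (Fp L) L := IsCMField.isQuadraticExtension L
  -- `N(t) ∈ L⁺`, `δ² ∈ L⁺`
  have hnt : IsCMField.complexConj L (IsCMField.complexConj L t * t) = IsCMField.complexConj L t * t := by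
    rw [map_mul, IsCMField.complexConj_apply_apply, mul_comm]
  set nt : Fp L := ⟨IsCMField.complexConj L t * t, (IsCMField.complexConj_eq_self_iff (K := L) _).1 hnt⟩ with hnt_def
  have hnt0 : nt ≠ 0 := fun h => by
    have h' : IsCMField.complexConj L t * t = 0 := by
      have := congrArg Subtype.val h
      simpa [hnt_def] using this
    rcases mul_eq_zero.1 h' with h1 | h1
    · exact ht (by simpa using congrArg (IsCMField.complexConj L) h1)
    · exact ht h1
  have hδ2 : imagUnitSq L ≠ 0 := fun h =>
    mul_ne_zero (imagUnit_ne_zero L) (imagUnit_ne_zero L) (by rw [imagUnit_mul_self, h, map_zero])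
  have hy : imagUnitSq L * (v * nt) ≠ 0 := mul_ne_zero hδ2 (mul_ne_zero hv hnt0)
  -- `σ δ = algebraMap (δ² · v · N(t))`
  have hσδ : σ * imagUnit L = algebraMap (Fp L) L (imagUnitSq L * (v * nt)) := by
    rw [map_mul, map_mul, ← imagUnit_mul_self, hσ]
    show imagUnit L * (v : L) * (IsCMField.complexConj L t * t) * imagUnit L = imagUnit L * imagUnit L * ((v : L) * (nt : L))
    rw [hnt_def]
    ring
  rw [hσδ, Algebra.trace_algebraMap, Algebra.IsQuadraticExtension.finrank_eq_two (Fp L) L, two_nsmul]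
  exact mul_ne_zero ht₁ (add_self_eq_zero.not.2 hy)

/-- **§2 THE CORNER DATA OF RECORD** (★ (K1a-1) with every letter discharged).  There are `σc : Skew_T(L) → L` and `gc : Skew_T(L) → H(𝔸)` — for a rank-one `S = u ⊗ w`:
`gc S = Λ(γ[w])` for the Levi chart `Λ` of ★ `exists_leviHom_blk_eq` and the row section `γ` of ★ `exists_normalised_rowSection`, `σc S = (D₀ S γ[w]⁻¹)₁₁` for the frame
block `D₀` of `Λ(γ[w])` (★ `exists_rat_levi_blocks_levi_map`) — such that for every rank-one `T_L`-skew `S` (`↑S ≠ 0`, `det ↑S = 0`):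
(i) `t₁ · Tr_{L∕L⁺}(σc(S)·δ) ≠ 0` (★ (V-b) `corner_eq_val₂_mul_norm` + `hval₂`: `σc S = δ · val₂ S · N(t)`), i.e. ★ p863366's hypothesis `hτ` at `σ := σc S`;
(ii) for EVERY Haar `νN` on `N_Δ(𝔸)`, every `χ`, `s` and every Siegel section `f ∈ I_Δ(s,χ)`: `W_S(f)(h) = W_{σc(S) E₁₁}(f)(gc S · h)` for all `h` (★ `conj_index_eq_single`,
★ `whittakerDelta_eq_whittakerDelta_conj_index`, Haar preservation ★ `measurePreserving_conj_levi`).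
[cite: KudlaRallis1994, §2 (2.10)–(2.12)] [cite: MoeglinWaldspurger1995, II.1.7] [cite: Shimura1997, §18.3–18.4] -/
theorem exists_cornerData_of_record (hdV0 : ∀ i, dV i ≠ 0) (hdW0 : ∀ i, dW i ≠ 0)
    [MeasurableSpace ↥(unipDelta L e dV hdV dW hdW)] [BorelSpace ↥(unipDelta L e dV hdV dW hdW)] :
    ∃ (σc : skewMatrices ((IsCMField.complexConj L : L ≃ₐ[Fp L] L) : L →+* L) ((gramR L e dV hdV dW hdW).map (algebraMap (Fp L) L)) → L)
      (gc : skewMatrices ((IsCMField.complexConj L : L ≃ₐ[Fp L] L) : L →+* L) ((gramR L e dV hdV dW hdW).map (algebraMap (Fp L) L)) → HA L e dV hdV dW hdW),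
      ∀ S : skewMatrices ((IsCMField.complexConj L : L ≃ₐ[Fp L] L) : L →+* L) ((gramR L e dV hdV dW hdW).map (algebraMap (Fp L) L)),
        (S : Matrix (Fin 2) (Fin 2) L) ≠ 0 → (S : Matrix (Fin 2) (Fin 2) L).det = 0 →
          gramR L e dV hdV dW hdW 1 1 * Algebra.trace (Fp L) L (σc S * imagUnit L) ≠ 0 ∧
          ∀ (νN : Measure ↥(unipDelta L e dV hdV dW hdW)) [νN.IsHaarMeasure] (χ : HeckeCharacter L) (s : ℂ) (f : HA L e dV hdV dW hdW → ℂ),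
            IsSiegelDeltaSection L e dV hdV dW hdW χ s f → ∀ h : HA L e dV hdV dW hdW,
              whittakerDelta L e dV hdV dW hdW νN (S : Matrix (Fin 2) (Fin 2) L) f h =
                whittakerDelta L e dV hdV dW hdW νN (Matrix.single 1 1 (σc S)) f (gc S * h) := by
  classical
  obtain ⟨Λ, hΛ⟩ := exists_leviHom_blk_eq L e dV hdV dW hdW hdV0 hdW0
  obtain ⟨γ, hγ, -⟩ := exists_normalised_rowSection (K := L)
  have key : ∀ S : skewMatrices ((IsCMField.complexConj L : L ≃ₐ[Fp L] L) : L →+* L) ((gramR L e dV hdV dW hdW).map (algebraMap (Fp L) L)),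
      ∃ (σ : L) (g : HA L e dV hdV dW hdW), (S : Matrix (Fin 2) (Fin 2) L) ≠ 0 → (S : Matrix (Fin 2) (Fin 2) L).det = 0 →
        gramR L e dV hdV dW hdW 1 1 * Algebra.trace (Fp L) L (σ * imagUnit L) ≠ 0 ∧
        ∀ (νN : Measure ↥(unipDelta L e dV hdV dW hdW)) [νN.IsHaarMeasure] (χ : HeckeCharacter L) (s : ℂ) (f : HA L e dV hdV dW hdW → ℂ),
          IsSiegelDeltaSection L e dV hdV dW hdW χ s f → ∀ h : HA L e dV hdV dW hdW,
            whittakerDelta L e dV hdV dW hdW νN (S : Matrix (Fin 2) (Fin 2) L) f h =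
              whittakerDelta L e dV hdV dW hdW νN (Matrix.single 1 1 σ) f (g * h) := by
    intro S
    by_cases hr : (S : Matrix (Fin 2) (Fin 2) L) ≠ 0 ∧ (S : Matrix (Fin 2) (Fin 2) L).det = 0
    · obtain ⟨u, w, hu, hw, hS1⟩ := exists_vecMulVec_of_det_eq_zero hr.1 hr.2
      obtain ⟨ha, D₀, hd, hrel, hD₀⟩ := exists_rat_levi_blocks_levi_map Λ hΛ hdV0 hdW0 (γ (Projectivization.mk L w hw))
      obtain ⟨hsingle, hσ0⟩ := conj_index_eq_single Λ hΛ hdV0 hdW0 S.2 hS1 hu hw γ hγ hd hD₀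
      refine ⟨(D₀ * (S : Matrix (Fin 2) (Fin 2) L) * (((γ (Projectivization.mk L w hw) : GL (Fin 2) L) : Matrix (Fin 2) (Fin 2) L))⁻¹) 1 1,
        Λ (Matrix.GeneralLinearGroup.map (algebraMap L (AdeleRing (𝓞 L) L)) (γ (Projectivization.mk L w hw))), fun _ _ => ⟨?_, ?_⟩⟩
      · -- (i) `τ(σc) ≠ 0`: `σc = δ · val₂ S · N(t)`
        obtain ⟨t, ht0, hσt⟩ := corner_eq_val₂_mul_norm L e dV hdV hdV0 dW hdW hdW0 (imagUnit_ne_zero L) (complexConj_imagUnit L) S.2 hr.1 hr.2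
          (γ (Projectivization.mk L w hw)) hrel hsingle
        exact mul_trace_mul_imagUnit_ne_zero L (hval₂ L e dV hdV hdV0 dW hdW hdW0 (imagUnit_ne_zero L) (complexConj_imagUnit L) _ S.2 hr.1 hr.2) ht0 hσt
          (gramR_apply_same_ne_zero L e dV hdV hdV0 dW hdW hdW0 1)
      · -- (ii) the transport identity for every Haar `νN` and every Siegel section
        intro νN _ χ s f hf h
        rw [← hsingle]
        exact whittakerDelta_eq_whittakerDelta_conj_index Λ hΛ hdV0 hdW0 νN hf (γ (Projectivization.mk L w hw))
          (measurePreserving_conj_levi Λ hΛ hdV0 hdW0 νN _) (Matrix.isUnits_det_units _) ha hd _ h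
    · exact ⟨0, 1, fun h0 hd => absurd ⟨h0, hd⟩ hr⟩
  choose σc gc hk using key
  exact ⟨σc, gc, hk⟩

end Corner

/-! ## §3 The head of a sliced family is the Σ∏ of the raw archimedean ∕ local integrals (any index, any point) -/

section Slice

open Summit.HodgeConjecture.HodgeConjecture.Cruxes.HLiu418.K2LiuSiegelEisensteinKindWPartFubini (jointWhittaker_eq_sum_mul_prod_of_sum_tensor)
open Summit.HodgeConjecture.HodgeConjecture.Cruxes.HLiu418.K2LiuKindWJointIntegrable (integrable_tensor_prod_pi)

variable {N M : ℕ} (e : Fin N × Fin M ≃ Fin 2)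
  (dV : Fin N → L) (hdV : ∀ i, IsCMField.complexConj L (dV i) = dV i)
  (dW : Fin M → L) (hdW : ∀ i, IsCMField.complexConj L (dW i) = dW i)
  [DecidableEq (HeightOneSpectrum (𝓞 (Fp L)))]
  [MeasurableSpace ↥(unipDeltaArch L e dV hdV dW hdW)]
  [∀ v : HeightOneSpectrum (𝓞 (Fp L)), MeasurableSpace ↥(unipDeltaLoc L e dV hdV dW hdW v)]

set_option maxHeartbeats 400000 in -- MEASURED class of ★ p862531 `jointWhittaker_eq_sum_mul_prod_of_sum_tensor` ∕ ★ `kindWPart_eq_sum_mul_prod_of_letters` (200 000 ✗ at the `isDefEq` unfolding `kindWPart` against ★ p862531's left-hand side, 400 000 ✓)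
/-- **§3 THE HEAD OF A SLICED FAMILY IS THE Σ∏ OF THE RAW LOCAL INTEGRALS** (the K1 twin of ★ `kindWPart_eq_sum_mul_prod_of_letters`, uncontinued; ANY index `S'`, any
point `h'`, any finite `T`): if the `T`-slices of `f` are the finite sum of pure tensors `Σ_j Finf j s a · ∏_{v:T} Fv j v s (y v)` (`hsliceT`) and every archimedean ∕ local
twisted factor is integrable (`hintA`, `hintL`), then `I_T(S',s,h') = Σ_j (∫ conj ψ_{S'}(ι_∞ a)·Finf j s((w_Δ)_∞ a h'_∞) dν_∞) · ∏_{v∈T} ∫ conj ψ_{S'}(ι_v y)·Fv j v s((w_Δ)_v y h'_v) dν_v`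
— ★ p862531 with the joint `hint` := ★ `integrable_tensor_prod_pi`, products re-indexed by `Finset.prod_coe_sort`. [cite: KudlaRallis1994, §2] [cite: CasselsFrohlichANT1967, Ch. XV Thm. 3.3.1] -/
theorem kindWPart_slice_eq_sum_mul_prod (T : Finset (HeightOneSpectrum (𝓞 (Fp L))))
    (νinfT : Measure ↥(unipDeltaArch L e dV hdV dW hdW)) [SigmaFinite νinfT]
    (νv : ∀ v : HeightOneSpectrum (𝓞 (Fp L)), Measure ↥(unipDeltaLoc L e dV hdV dW hdW v)) [∀ v, SigmaFinite (νv v)]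
    {f : ℂ → HA L e dV hdV dW hdW → ℂ} {m : ℕ}
    (Finf : Fin m → ℂ → UnitaryGroup.arch (Fp L) L (IsCMField.complexConj L) (2 + 2) (hermD L e dV hdV dW hdW) → ℂ)
    (Fv : Fin m → ∀ v : HeightOneSpectrum (𝓞 (Fp L)), ℂ → UnitaryGroup.localPi L (IsCMField.complexConj L) (2 + 2) (hermD L e dV hdV dW hdW) v → ℂ)
    (hsliceT : ∀ (s : ℂ) (a : UnitaryGroup.arch (Fp L) L (IsCMField.complexConj L) (2 + 2) (hermD L e dV hdV dW hdW))
        (y : Π v : ↥T, UnitaryGroup.localPi L (IsCMField.complexConj L) (2 + 2) (hermD L e dV hdV dW hdW) v.1),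
        f s (placesEmbed L (hermD L e dV hdV dW hdW) T (a, y)) = ∑ j, Finf j s a * ∏ v : ↥T, Fv j v.1 s (y v))
    (S' : Matrix (Fin 2) (Fin 2) L) (s : ℂ) (h' : HA L e dV hdV dW hdW)
    (hintA : ∀ j : Fin m, Integrable (fun a : ↥(unipDeltaArch L e dV hdV dW hdW) =>
        conj (unipDeltaChar L e dV hdV dW hdW S'
            (UnitaryGroup.archToAdelic (Fp L) L (IsCMField.complexConj L) (2 + 2) (hermD L e dV hdV dW hdW)
              (a : UnitaryGroup.arch (Fp L) L (IsCMField.complexConj L) (2 + 2) (hermD L e dV hdV dW hdW))) : ℂ) *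
          Finf j s (UnitaryGroup.archPart (Fp L) L (IsCMField.complexConj L) (2 + 2) (hermD L e dV hdV dW hdW) (weylDelta L e dV hdV dW hdW) *
              (a : UnitaryGroup.arch (Fp L) L (IsCMField.complexConj L) (2 + 2) (hermD L e dV hdV dW hdW)) *
              UnitaryGroup.archPart (Fp L) L (IsCMField.complexConj L) (2 + 2) (hermD L e dV hdV dW hdW) h')) νinfT)
    (hintL : ∀ (j : Fin m) (v : ↥T), Integrable (fun y : ↥(unipDeltaLoc L e dV hdV dW hdW v.1) =>
        conj (unipDeltaChar L e dV hdV dW hdW S'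
            (locToAdelic L e dV hdV dW hdW v.1 (y : UnitaryGroup.localPi L (IsCMField.complexConj L) (2 + 2) (hermD L e dV hdV dW hdW) v.1)) : ℂ) *
          Fv j v.1 s (UnitaryGroup.evalPlace (Fp L) L (IsCMField.complexConj L) (2 + 2) (hermD L e dV hdV dW hdW) v.1
                (UnitaryGroup.finPart (Fp L) L (IsCMField.complexConj L) (2 + 2) (hermD L e dV hdV dW hdW) (weylDelta L e dV hdV dW hdW)) *
              (y : UnitaryGroup.localPi L (IsCMField.complexConj L) (2 + 2) (hermD L e dV hdV dW hdW) v.1) *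
              UnitaryGroup.evalPlace (Fp L) L (IsCMField.complexConj L) (2 + 2) (hermD L e dV hdV dW hdW) v.1
                (UnitaryGroup.finPart (Fp L) L (IsCMField.complexConj L) (2 + 2) (hermD L e dV hdV dW hdW) h'))) (νv v.1)) :
    kindWPart L e dV hdV dW hdW T νinfT νv (fun s x => f s (placesEmbed L (hermD L e dV hdV dW hdW) T x)) S' s h' =
      ∑ j, (∫ a, conj (unipDeltaChar L e dV hdV dW hdW S'
            (UnitaryGroup.archToAdelic (Fp L) L (IsCMField.complexConj L) (2 + 2) (hermD L e dV hdV dW hdW)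
              (a : UnitaryGroup.arch (Fp L) L (IsCMField.complexConj L) (2 + 2) (hermD L e dV hdV dW hdW))) : ℂ) *
          Finf j s (UnitaryGroup.archPart (Fp L) L (IsCMField.complexConj L) (2 + 2) (hermD L e dV hdV dW hdW) (weylDelta L e dV hdV dW hdW) *
              (a : UnitaryGroup.arch (Fp L) L (IsCMField.complexConj L) (2 + 2) (hermD L e dV hdV dW hdW)) *
              UnitaryGroup.archPart (Fp L) L (IsCMField.complexConj L) (2 + 2) (hermD L e dV hdV dW hdW) h') ∂νinfT) *
        ∏ v ∈ T, ∫ y, conj (unipDeltaChar L e dV hdV dW hdW S'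
            (locToAdelic L e dV hdV dW hdW v (y : UnitaryGroup.localPi L (IsCMField.complexConj L) (2 + 2) (hermD L e dV hdV dW hdW) v)) : ℂ) *
          Fv j v s (UnitaryGroup.evalPlace (Fp L) L (IsCMField.complexConj L) (2 + 2) (hermD L e dV hdV dW hdW) v
                (UnitaryGroup.finPart (Fp L) L (IsCMField.complexConj L) (2 + 2) (hermD L e dV hdV dW hdW) (weylDelta L e dV hdV dW hdW)) *
              (y : UnitaryGroup.localPi L (IsCMField.complexConj L) (2 + 2) (hermD L e dV hdV dW hdW) v) *
              UnitaryGroup.evalPlace (Fp L) L (IsCMField.complexConj L) (2 + 2) (hermD L e dV hdV dW hdW) v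
                (UnitaryGroup.finPart (Fp L) L (IsCMField.complexConj L) (2 + 2) (hermD L e dV hdV dW hdW) h')) ∂(νv v) := by
  have h2 := jointWhittaker_eq_sum_mul_prod_of_sum_tensor L e dV hdV dW hdW T νinfT νv
    (fT := fun s x => f s (placesEmbed L (hermD L e dV hdV dW hdW) T x)) (Finf := Finf) (Fv := fun j (v : ↥T) => Fv j v.1)
    (fun s a x => hsliceT s a x) S' s h'
    (fun j => integrable_tensor_prod_pi νinfT (fun v : ↥T => νv v.1)
      (fun a : ↥(unipDeltaArch L e dV hdV dW hdW) => conj (unipDeltaChar L e dV hdV dW hdW S'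
        (UnitaryGroup.archToAdelic (Fp L) L (IsCMField.complexConj L) (2 + 2) (hermD L e dV hdV dW hdW)
          (a : UnitaryGroup.arch (Fp L) L (IsCMField.complexConj L) (2 + 2) (hermD L e dV hdV dW hdW))) : ℂ))
      (fun a : ↥(unipDeltaArch L e dV hdV dW hdW) => Finf j s (UnitaryGroup.archPart (Fp L) L (IsCMField.complexConj L) (2 + 2) (hermD L e dV hdV dW hdW) (weylDelta L e dV hdV dW hdW) *
        (a : UnitaryGroup.arch (Fp L) L (IsCMField.complexConj L) (2 + 2) (hermD L e dV hdV dW hdW)) *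
        UnitaryGroup.archPart (Fp L) L (IsCMField.complexConj L) (2 + 2) (hermD L e dV hdV dW hdW) h'))
      (fun v (y : ↥(unipDeltaLoc L e dV hdV dW hdW v.1)) => conj (unipDeltaChar L e dV hdV dW hdW S'
        (locToAdelic L e dV hdV dW hdW v.1 (y : UnitaryGroup.localPi L (IsCMField.complexConj L) (2 + 2) (hermD L e dV hdV dW hdW) v.1)) : ℂ))
      (fun v (y : ↥(unipDeltaLoc L e dV hdV dW hdW v.1)) => Fv j v.1 s (UnitaryGroup.evalPlace (Fp L) L (IsCMField.complexConj L) (2 + 2) (hermD L e dV hdV dW hdW) v.1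
          (UnitaryGroup.finPart (Fp L) L (IsCMField.complexConj L) (2 + 2) (hermD L e dV hdV dW hdW) (weylDelta L e dV hdV dW hdW)) *
        (y : UnitaryGroup.localPi L (IsCMField.complexConj L) (2 + 2) (hermD L e dV hdV dW hdW) v.1) *
        UnitaryGroup.evalPlace (Fp L) L (IsCMField.complexConj L) (2 + 2) (hermD L e dV hdV dW hdW) v.1
          (UnitaryGroup.finPart (Fp L) L (IsCMField.complexConj L) (2 + 2) (hermD L e dV hdV dW hdW) h')))
      (hintA j) (fun v => hintL j v))
  refine (show kindWPart L e dV hdV dW hdW T νinfT νv (fun s x => f s (placesEmbed L (hermD L e dV hdV dW hdW) T x)) S' s h' = _ from h2).trans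
    (Finset.sum_congr rfl fun j _ => ?_)
  rw [← Finset.prod_coe_sort T]

end Slice

end Summit.HodgeConjecture.HodgeConjecture.Cruxes.HLiu418.K2LiuKindOneSingularTailEuler

end
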